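import Mathlib
import Literature.Computability.AlgebraicComplexity.GroupTheoreticMatMul
import Literature.Barriers.MatrixMultiplication.TricoloredSumFreeBarrier
import Summits.MatrixMultiplication.MatrixMultiplication.Theorems.AbelianSTPPCensusSieveRulesStabiliser
import Summits.MatrixMultiplication.MatrixMultiplication.Theorems.GroupTheoreticSTPPCAbelianObstructionNegSlack
import Summits.MatrixMultiplication.MatrixMultiplication.Theorems.AbelianSTPPSieve

/-!
# Sieve rules for STPP families in finite abelian groups, III: the reversal pair clauses (U14-T″) and sieve soundness

Support file for route `MatrixMultiplication/GroupTheoreticSTPP`, negative crux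
`stmt-MatrixMultiplication-0596` (`CAbelianObstructionNeg`); cell mm-stpp, rung F-M1 (port of the planner's
HOME/mm-stpp-plan/PackingSketch.lean, section ReversalPair, and the rotated U14).

Census `IsSTPP` is invariant under the reversal `(A,B,C) ↦ (−C,−B,−A)` as well as under rotation; read
through it, bc-tightness of U14 stabilises the SAME set `A l − B l + C l` under `A l − A l`
(`disjoint_subBC_reflect`, `reflect_eq_of_tight_bc`, `sgnSum_image_add_sub_eq_of_tight_bc`), so the PAIR
CLAUSE holds in PRODUCT form with no coset hypothesis: ab ∧ bc tight at `l` ⇒ `∃ d ≥ |A l||C l|`,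
`d ∣ V l`, `d ∣ |H|` (`exists_dvd_of_tight_ab_bc`; rotations `_bc_ca` (`≥ |A l||B l|`), `_ca_ab`
(`≥ |B l||C l|`)).  Also the rotated U14 (`volume_add_sum_card_mul_le_bc/_ca`).

Finally the ASSEMBLY `AbelianTECensus.sieveAdmissible_of_isSTPP` / `sieveSound`: every STPP family with
non-empty sets in a finite abelian group satisfies `SieveAdmissible |H|` (`Theorems/AbelianSTPPSieve.lean`,
rule set vM: U1, Neumann, U2, U11 per member (`STPPSlack.slack_A/B/C`, p406139), U13, U9′, U14, U14-T,
U14-T″) at its shape list — verbatim the statement of the support item `SieveSound` of the draft route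
`AbelianSTPPCensus` (HOME/mm-stpp-plan/route/Sketch.lean).  This is the soundness half of the cell's census
instrument: every «EXCLUDED by sieve» row rests on these kernel inequalities plus the arithmetic search.

WHAT THIS IS NOT: no `ω` statement; necessary conditions only.
-/

-- single-conjunct summit: the mandated namespace repeats `MatrixMultiplication`.
set_option linter.dupNamespace false

namespace Summit.MatrixMultiplication.MatrixMultiplication.Theorems

namespace STPPSieveRules

open Finset Literature.Computability.AlgebraicComplexity

variable {H : Type*} [AddCommGroup H] [DecidableEq H] {N : ℕ} {A B C : Fin N → Finset H}

/-! ### Reversal: bc-tightness ALSO stabilises `S l = A l − B l + C l` (under `A l − A l`)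

Census `IsSTPP` is invariant under the reversal `(A, B, C) ↦ (−C, −B, −A)` as well as under rotation;
read through the reversal, the bc-rotation of U14 is proved from pattern `(l, t, l)`: the sets
`B t − C t` (`t ≠ l`, pairwise disjoint, `|B t||C t|` elements) avoid the REFLECTED translate
`a₀ − (A l − B l + C l)` for every `a₀ ∈ A l`.  Hence bc-tightness at `l` makes `a₀ − S l` independent
of `a₀`, i.e. `S l` is invariant under `A l − A l` — the SAME set that ab-tightness makes invariant under
`C l − C l`.  Consequently (pair clause, corrected and strengthened): ab-tight ∧ bc-tight at `l` ⇒ the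
stabiliser of `S l` contains `(A l − a₀) + (C l − u₀)`, which has `|A l||C l|` elements by TPP(l), so
`∃ d, |A l||C l| ≤ d ∧ d ∣ V l ∧ d ∣ |H|` with NO coset hypothesis; rotations give `|A l||B l|` (bc ∧ ca,
on `A + B − C`) and `|B l||C l|` (ca ∧ ab, on `−A + B + C`). -/

section ReversalPair

/-- Pattern `(l, t, l)`, `t ≠ l`: `B t − C t` avoids `a₀ − (A l − B l + C l)` (`a₀ ∈ A l`). -/
theorem disjoint_subBC_reflect (h : IsSTPP A B C) {t l : Fin N} (htl : t ≠ l) {a₀ : H}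
    (ha₀ : a₀ ∈ A l) :
    Disjoint (((B t) ×ˢ (C t)).image (fun p : H × H => p.1 - p.2))
      ((((A l) ×ˢ (B l) ×ˢ (C l)).image sgnSum).image (fun x => a₀ - x)) := by
  rw [disjoint_left]
  intro x hx hx'
  simp only [mem_image, mem_product, Prod.exists, sgnSum] at hx hx'
  obtain ⟨t', u, ⟨ht', hu⟩, rfl⟩ := hx
  obtain ⟨y, ⟨s', t₀, u', ⟨hs', ht₀, hu'⟩, rfl⟩, he⟩ := hx'
  -- he : a₀ - (s' - t₀ + u') = t' - u  ⇒  (s' - a₀) + (t' - t₀) + (u' - u) = 0, indices (l, t, l)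
  have key : (s' - a₀) + (t' - t₀) + (u' - u) = 0 := by
    have : t' - u - (a₀ - (s' - t₀ + u')) = 0 := by rw [← he]; abel
    rw [← this]; abel
  obtain ⟨hlt, -, -⟩ := h l t l a₀ ha₀ s' hs' t₀ ht₀ t' ht' u hu u' hu' key
  exact htl hlt.symm

/-- bc-tightness at `l` ⇒ all reflected translates `a − S l`, `a ∈ A l`, coincide. -/
theorem reflect_eq_of_tight_bc (h : IsSTPP A B C) [Fintype H] (l : Fin N)
    (hA : ∀ t, (A t).Nonempty)
    (htight : (B l).card * (C l).card * (A l).card + ∑ t ∈ univ.erase l, (B t).card * (C t).card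
      = Fintype.card H)
    {a₀ a₁ : H} (ha₀ : a₀ ∈ A l) (ha₁ : a₁ ∈ A l) :
    ((((A l) ×ˢ (B l) ×ˢ (C l)).image sgnSum).image (fun x => a₀ - x)) =
      ((((A l) ×ˢ (B l) ×ˢ (C l)).image sgnSum).image (fun x => a₁ - x)) := by
  classical
  set S : Finset H := ((A l) ×ˢ (B l) ×ˢ (C l)).image sgnSum with hS
  set E : Fin N → Finset H := fun t => ((B t) ×ˢ (C t)).image (fun p : H × H => p.1 - p.2) with hE
  set R : Finset H := univ \ (univ.erase l).biUnion E with hR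
  have hsub : ∀ {a : H}, a ∈ A l → S.image (fun x => a - x) ⊆ R := by
    intro a ha x hx
    rw [hR, mem_sdiff]
    refine ⟨mem_univ _, ?_⟩
    intro hx'
    rw [mem_biUnion] at hx'
    obtain ⟨t, ht, hxt⟩ := hx'
    have hd := disjoint_subBC_reflect h (ne_of_mem_erase ht) ha
    exact disjoint_left.mp hd hxt hx
  have hcardT : ∀ {a : H}, a ∈ A l →
      (S.image (fun x => a - x)).card = (A l).card * (B l).card * (C l).card := by
    intro a _
    rw [card_image_of_injective _ (sub_right_injective), hS, card_image_sgnSum h l]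
  have hpair : (↑(univ.erase l) : Set (Fin N)).PairwiseDisjoint E := by
    intro t _ s _ hts
    exact disjoint_sub_sub h.rotate hts (hA s)
  have hcardR : R.card = (A l).card * (B l).card * (C l).card := by
    have h1 : R.card = Fintype.card H - ((univ.erase l).biUnion E).card := by
      rw [hR, card_univ_sdiff]
    rw [card_biUnion hpair] at h1
    have hsum : ∑ t ∈ univ.erase l, (E t).card = ∑ t ∈ univ.erase l, (B t).card * (C t).card :=
      sum_congr rfl (fun t _ => card_image_sub h.rotate t (hA t))
    rw [hsum] at h1
    have e3 : (B l).card * (C l).card * (A l).card = (A l).card * (B l).card * (C l).card := by ring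
    omega
  have heq : ∀ {a : H}, a ∈ A l → S.image (fun x => a - x) = R := fun ha =>
    eq_of_subset_of_card_le (hsub ha) (by rw [hcardR, hcardT ha])
  rw [heq ha₀, heq ha₁]

/-- Corollary: under bc-tightness at `l`, `S l` is invariant under every difference of elements of `A l`. -/
theorem sgnSum_image_add_sub_eq_of_tight_bc (h : IsSTPP A B C) [Fintype H] (l : Fin N)
    (hA : ∀ t, (A t).Nonempty)
    (htight : (B l).card * (C l).card * (A l).card + ∑ t ∈ univ.erase l, (B t).card * (C t).card
      = Fintype.card H)
    {a₀ a₁ : H} (ha₀ : a₀ ∈ A l) (ha₁ : a₁ ∈ A l) :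
    (((A l) ×ˢ (B l) ×ˢ (C l)).image sgnSum).image (fun x => x + (a₀ - a₁)) =
      ((A l) ×ˢ (B l) ×ˢ (C l)).image sgnSum := by
  classical
  have key := congrArg (fun T : Finset H => T.image (fun x => a₀ - x))
    (reflect_eq_of_tight_bc h l hA htight ha₁ ha₀)
  simp only [image_image, Function.comp_def, sub_sub_cancel] at key
  -- key : P.image (fun p => a₀ - (a₁ - sgnSum p)) = P.image sgnSum   (or already normalised)
  rw [image_image]
  have hfun : ((fun x : H => x + (a₀ - a₁)) ∘ sgnSum) =
      (fun p : H × H × H => a₀ - (a₁ - sgnSum p)) := by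
    funext p
    simp only [Function.comp]
    abel
  rw [hfun]
  exact key

/-- **Pair clause (ab ∧ bc), kernel form.** If both the ab- and the bc-rotation of U14 are tight at `l`,
then some `d` with `|A l|·|C l| ≤ d` divides `V l` and `|H|` (the stabiliser of `S l` contains
`(A l − a₀) + (C l − u₀)`, `|A l||C l|` elements by TPP(l)).  No coset hypothesis. -/
theorem exists_dvd_of_tight_ab_bc (h : IsSTPP A B C) [Fintype H] (l : Fin N)
    (hA : ∀ t, (A t).Nonempty) (hBne : (B l).Nonempty) (hC : ∀ t, (C t).Nonempty)
    (ht_ab : (A l).card * (B l).card * (C l).card + ∑ t ∈ univ.erase l, (A t).card * (B t).card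
      = Fintype.card H)
    (ht_bc : (B l).card * (C l).card * (A l).card + ∑ t ∈ univ.erase l, (B t).card * (C t).card
      = Fintype.card H) :
    ∃ d : ℕ, (A l).card * (C l).card ≤ d ∧ d ∣ (A l).card * (B l).card * (C l).card ∧
      d ∣ Fintype.card H := by
  classical
  obtain ⟨u₀, hu₀⟩ := hC l
  obtain ⟨a₀, ha₀⟩ := hA l
  obtain ⟨hdV, hdH⟩ := closure_core_of_tight h l hC ht_ab hu₀ (↑((A l).image (fun a => a - a₀)))
    (fun g hg => by
      rw [Finset.mem_coe, mem_image] at hg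
      obtain ⟨a, ha, rfl⟩ := hg
      exact sgnSum_image_add_sub_eq_of_tight_bc h l hA ht_bc ha ha₀)
  refine ⟨_, ?_, hdV, hdH⟩
  rw [← card_image_add_AC h l hBne,
    ← card_image_of_injective _ (sub_left_injective (b := a₀ + u₀))]
  apply card_le_natCard_of_subset
  intro y hy
  rw [mem_image] at hy
  obtain ⟨x, hx, rfl⟩ := hy
  rw [mem_image] at hx
  obtain ⟨⟨s, u⟩, hp, rfl⟩ := hx
  simp only [mem_product] at hp
  obtain ⟨hs, hu⟩ := hp
  have hsa : s - a₀ ∈ AddSubgroup.closure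
      ((↑((A l).image (fun a => a - a₀)) : Set H) ∪ ↑((C l).image (fun u => u - u₀))) :=
    AddSubgroup.subset_closure (Or.inl (Finset.mem_coe.mpr (mem_image_of_mem _ hs)))
  have huc : u - u₀ ∈ AddSubgroup.closure
      ((↑((A l).image (fun a => a - a₀)) : Set H) ∪ ↑((C l).image (fun u => u - u₀))) :=
    AddSubgroup.subset_closure (Or.inr (Finset.mem_coe.mpr (mem_image_of_mem _ hu)))
  have e : (s + u) - (a₀ + u₀) = (s - a₀) + (u - u₀) := by abel
  simp only
  rw [e]
  exact AddSubgroup.add_mem _ hsa huc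

/-- Rotation: bc ∧ ca tight at `l` ⇒ `∃ d ≥ |A l|·|B l|` dividing `V l` and `|H|` (set `A + B − C`). -/
theorem exists_dvd_of_tight_bc_ca (h : IsSTPP A B C) [Fintype H] (l : Fin N)
    (hA : ∀ t, (A t).Nonempty) (hB : ∀ t, (B t).Nonempty) (hCne : (C l).Nonempty)
    (ht_bc : (B l).card * (C l).card * (A l).card + ∑ t ∈ univ.erase l, (B t).card * (C t).card
      = Fintype.card H)
    (ht_ca : (C l).card * (A l).card * (B l).card + ∑ t ∈ univ.erase l, (C t).card * (A t).card
      = Fintype.card H) :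
    ∃ d : ℕ, (B l).card * (A l).card ≤ d ∧ d ∣ (B l).card * (C l).card * (A l).card ∧
      d ∣ Fintype.card H :=
  exists_dvd_of_tight_ab_bc h.rotate l hB hCne hA ht_bc ht_ca

/-- Rotation: ca ∧ ab tight at `l` ⇒ `∃ d ≥ |B l|·|C l|` dividing `V l` and `|H|` (set `−A + B + C`). -/
theorem exists_dvd_of_tight_ca_ab (h : IsSTPP A B C) [Fintype H] (l : Fin N)
    (hANe : (A l).Nonempty) (hB : ∀ t, (B t).Nonempty) (hC : ∀ t, (C t).Nonempty)
    (ht_ca : (C l).card * (A l).card * (B l).card + ∑ t ∈ univ.erase l, (C t).card * (A t).card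
      = Fintype.card H)
    (ht_ab : (A l).card * (B l).card * (C l).card + ∑ t ∈ univ.erase l, (A t).card * (B t).card
      = Fintype.card H) :
    ∃ d : ℕ, (C l).card * (B l).card ≤ d ∧ d ∣ (C l).card * (A l).card * (B l).card ∧
      d ∣ Fintype.card H :=
  exists_dvd_of_tight_ab_bc h.rotate.rotate l hC hANe hB ht_ca ht_ab

end ReversalPair

/-! ### Rotated U14 (bc and ca), via `isSTPP_rotate` -/

/-- **U14, bc-rotation**: `V l + Σ_{t ≠ l} |B t||C t| ≤ |H|` (all `A t ≠ ∅`). [original] -/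
theorem volume_add_sum_card_mul_le_bc (h : IsSTPP A B C) [Fintype H] (l : Fin N)
    (hA : ∀ t, (A t).Nonempty) :
    (B l).card * (C l).card * (A l).card + ∑ t ∈ univ.erase l, (B t).card * (C t).card
      ≤ Fintype.card H :=
  volume_add_sum_card_mul_le h.rotate l hA

/-- **U14, ca-rotation**: `V l + Σ_{t ≠ l} |C t||A t| ≤ |H|` (all `B t ≠ ∅`). [original] -/
theorem volume_add_sum_card_mul_le_ca (h : IsSTPP A B C) [Fintype H] (l : Fin N)
    (hB : ∀ t, (B t).Nonempty) :
    (C l).card * (A l).card * (B l).card + ∑ t ∈ univ.erase l, (C t).card * (A t).card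
      ≤ Fintype.card H :=
  volume_add_sum_card_mul_le h.rotate.rotate l hB

end STPPSieveRules

/-! ### Assembly: every STPP family with non-empty sets satisfies `SieveAdmissible |H|` -/

namespace AbelianTECensus

open Finset Literature.Computability.AlgebraicComplexity STPPSieveRules

/-- **Sieve soundness** (body of the route support `SieveSound` of draft route `AbelianSTPPCensus`): an
STPP family with all sets non-empty in a finite abelian group `H` satisfies the sieve system
`SieveAdmissible |H|` (rule set vM: U1, Neumann, U2, U11 per member, U13, U9′, U14 with the tightness
clauses U14-T and the reversal pair clauses U14-T″) at its shape list. [original] -/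
theorem sieveAdmissible_of_isSTPP {H : Type*} [AddCommGroup H] [Fintype H] {N : ℕ}
    {A B C : Fin N → Finset H} (h : IsSTPP A B C)
    (hne : ∀ i, (A i).Nonempty ∧ (B i).Nonempty ∧ (C i).Nonempty) :
    SieveAdmissible (Fintype.card H) (fun i => (A i).card) (fun i => (B i).card)
      (fun i => (C i).card) := by
  classical
  have hA : ∀ i, (A i).Nonempty := fun i => (hne i).1
  have hB : ∀ i, (B i).Nonempty := fun i => (hne i).2.1
  have hC : ∀ i, (C i).Nonempty := fun i => (hne i).2.2
  have hV : ∀ i, (A i).card * (B i).card * (C i).card ≤ Fintype.card H := fun i => by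
    have := card_le_univ (((A i) ×ˢ (B i) ×ˢ (C i)).image (sgnSum (H := H)))
    rwa [card_image_sgnSum h i] at this
  have rbca : ∀ i, (B i).card * (C i).card * (A i).card = (A i).card * (B i).card * (C i).card :=
    fun i => by ring
  have rcab : ∀ i, (C i).card * (A i).card * (B i).card = (A i).card * (B i).card * (C i).card :=
    fun i => by ring
  simp only [SieveAdmissible, shapeVol, u14Sum, HasLargeCommonDivisor]
  refine ⟨?_, ?_, h.packing hA hB hC, ?_, ?_, ?_, ?_⟩
  · intro i
    exact ⟨(hA i).card_pos, (hB i).card_pos, (hC i).card_pos, hV i⟩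
  · intro i
    have h1 := STPPSlack.slack_A h hB hC i
    have h2 := STPPSlack.slack_B h hC hA i
    have h3 := STPPSlack.slack_C h hA hB i
    have e1 := single_le_sum (f := fun t => (A t).card * ((B t).card + (C t).card))
      (fun _ _ => Nat.zero_le _) (mem_univ i)
    have e2 := single_le_sum (f := fun t => (B t).card * ((C t).card + (A t).card))
      (fun _ _ => Nat.zero_le _) (mem_univ i)
    have e3 := single_le_sum (f := fun t => (C t).card * ((A t).card + (B t).card))
      (fun _ _ => Nat.zero_le _) (mem_univ i)
    refine ⟨?_, ?_, ?_⟩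
    · rw [Nat.mul_sub_one]; omega
    · rw [Nat.mul_sub_one]; omega
    · rw [Nat.mul_sub_one]; omega
  · intro i
    exact ⟨STPPSlack.slack_A h hB hC i, STPPSlack.slack_B h hC hA i, STPPSlack.slack_C h hA hB i⟩
  · intro i j hij
    have v1 : (A i).card * (B i).card * (C i).card + (C i).card ≤ Fintype.card H := by
      refine Nat.le_of_not_lt fun hlt => ?_
      rcases isolated_of_volume_add_card_gt h hij hlt with h0 | h0
      · exact (hA j).ne_empty h0
      · exact (hB j).ne_empty h0
    have v2 : (A i).card * (B i).card * (C i).card + (A i).card ≤ Fintype.card H := by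
      refine Nat.le_of_not_lt fun hlt => ?_
      rw [← rbca i] at hlt
      rcases isolated_of_volume_add_card_gt h.rotate hij hlt with h0 | h0
      · exact (hB j).ne_empty h0
      · exact (hC j).ne_empty h0
    have v3 : (A i).card * (B i).card * (C i).card + (B i).card ≤ Fintype.card H := by
      refine Nat.le_of_not_lt fun hlt => ?_
      rw [← rcab i] at hlt
      rcases isolated_of_volume_add_card_gt h.rotate.rotate hij hlt with h0 | h0
      · exact (hC j).ne_empty h0
      · exact (hA j).ne_empty h0
    have p1 := card_mul_add_volume_le h hij.symm (hC i) (hC j)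
    have p2 := card_mul_add_volume_le h.rotate hij.symm (hA i) (hA j)
    have p3 := card_mul_add_volume_le h.rotate.rotate hij.symm (hB i) (hB j)
    rw [rbca j] at p2
    rw [rcab j] at p3
    exact ⟨v2, v3, v1, p1, p2, p3⟩
  · intro l
    refine ⟨volume_add_sum_card_mul_le h l hC, fun ht => exists_dvd_of_tight h l hC ht, ?_, ?_, ?_, ?_⟩
    · have := volume_add_sum_card_mul_le_bc h l hA
      rwa [rbca l] at this
    · intro ht
      rw [← rbca l] at ht
      obtain ⟨d, h1, h2, h3⟩ := exists_dvd_of_tight_bc h l hA ht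
      exact ⟨d, h1, by rwa [rbca l] at h2, h3⟩
    · have := volume_add_sum_card_mul_le_ca h l hB
      rwa [rcab l] at this
    · intro ht
      rw [← rcab l] at ht
      obtain ⟨d, h1, h2, h3⟩ := exists_dvd_of_tight_ca h l hB ht
      exact ⟨d, h1, by rwa [rcab l] at h2, h3⟩
  · intro l
    refine ⟨fun hab hbc => ?_, fun hbc hca => ?_, fun hca hab => ?_⟩
    · rw [← rbca l] at hbc
      exact exists_dvd_of_tight_ab_bc h l hA (hB l) hC hab hbc
    · rw [← rbca l] at hbc
      rw [← rcab l] at hca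
      obtain ⟨d, h1, h2, h3⟩ := exists_dvd_of_tight_bc_ca h l hA hB (hC l) hbc hca
      exact ⟨d, h1, by rwa [rbca l] at h2, h3⟩
    · rw [← rcab l] at hca
      obtain ⟨d, h1, h2, h3⟩ := exists_dvd_of_tight_ca_ab h l (hA l) hB hC hca hab
      exact ⟨d, h1, by rwa [rcab l] at h2, h3⟩

/-- **`SieveSound`, verbatim** (the statement of the route support item of draft route
`AbelianSTPPCensus`, HOME/mm-stpp-plan/route/Sketch.lean): for every finite abelian group and every STPP
family with non-empty sets, `SieveAdmissible |H|` holds at the shape list. [original] -/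
theorem sieveSound :
    ∀ (H : Type) [AddCommGroup H] [Fintype H] (N : ℕ) (A B C : Fin N → Finset H), IsSTPP A B C →
      (∀ i, (A i).Nonempty ∧ (B i).Nonempty ∧ (C i).Nonempty) →
        SieveAdmissible (Fintype.card H) (fun i => (A i).card) (fun i => (B i).card)
          (fun i => (C i).card) :=
  fun _ _ _ _ _ _ _ h hne => sieveAdmissible_of_isSTPP h hne

end AbelianTECensus

end Summit.MatrixMultiplication.MatrixMultiplication.Theorems
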